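import Mathlib.Tactic
import HarnessLib
import HarnessLib.Audit.Tags
import Summits.CriticalPhenomena.PercolationContinuityZ3.Theorems.PercNearOneGluingNoHeavyLowerTailSahiAntichainTwoThreeFa

/-!
# Antichains, meets plus joins: statement (F) — two members above a five-label triple with no new meet give three new joins

Support file (seat `prim-masterthm-p1`, gen 37; `--supports stmt-CriticalPhenomena-4575`).  No `sorry`, no new definitions, standard
axioms.  Memo `run/shared/lean/prim/prim-masterthm/FROM-prim-masterthm-p1-g37-LINEAR-REDUCTION.md` §8.5/§9.1.

SETTING: L3 (`f(5) ≥ 10`) ⟸ H23 ⟸ (S), (C), (F) (`h23_of`, `…TwoThreeA`); (S) is `…TwoThreeS`, (C) is `…TwoThreeC`.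

NEW HERE ([this work], gen 37): **(F)** (`three_le_card_newJoins_of_two_three_five`): at a point with exactly two members above and three
members below forming neither a sunflower nor a co-sunflower, with at most five labels of their own, if no cross meet is new then at least
three cross joins are new.  A non-(co)sunflower triple with five labels has `(#meets, #joins) = (3,2)` or `(2,3)`; by pigeonhole two joins
(resp. meets) coincide and share a member; type (3,2) contradicts «no new meet» (`newMeets_nonempty_of_union_eq`, `…TwoThreeFa`), type (2,3)
gives three new joins (`three_le_card_newJoins_of_inter_eq`).
HONEST FRAMING: unconditional; with (S), (C) this closes H23 and L3 (assembly in `…TwoThreeA`); L4, V5 remain OPEN. [this work]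
-/

namespace Summit.CriticalPhenomena.PercolationContinuityZ3.Theorems.SahiColouredDaykin

open Finset

variable {α : Type*} [DecidableEq α]

/-! ### Statement (F) -/

/-- **(F)**: two members above; three members below forming neither a sunflower nor a co-sunflower, with at most five labels of their own;
if no cross meet is new then at least three cross joins are new. [this work] -/
theorem three_le_card_newJoins_of_two_three_five {P : Finset (Finset α)} {r : α}
    (hanti : IsAntichain (· ⊆ ·) (P : Set (Finset α))) (hA2 : #(above P r) = 2) (hB3 : #(below P r) = 3)
    (hnotS : ¬ ∃ K, ∀ b ∈ below P r, ∀ b' ∈ below P r, b ≠ b' → b ∩ b' = K)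
    (hnotC : ¬ ∃ U, ∀ b ∈ below P r, ∀ b' ∈ below P r, b ≠ b' → b ∪ b' = U)
    (hf : #(meets (below P r)) + #(joins (below P r)) ≤ 5) (h0 : newMeets P r = ∅) : 3 ≤ #(newJoins P r) := by
  have hantiB := isAntichain_below hanti r
  obtain ⟨b₁, b₂, b₃, h12, h13, h23, hB⟩ := card_eq_three.1 hB3
  have hall : ∀ b ∈ below P r, b = b₁ ∨ b = b₂ ∨ b = b₃ := by
    intro b hb; rw [hB, mem_insert, mem_insert, mem_singleton] at hb; exact hb
  have hb₁ : b₁ ∈ below P r := by rw [hB]; simp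
  have hb₂ : b₂ ∈ below P r := by rw [hB]; simp
  have hb₃ : b₃ ∈ below P r := by rw [hB]; simp
  obtain ⟨a, ha⟩ : (above P r).Nonempty := card_pos.1 (by omega)
  -- neither side count is ≤ 1
  have hL2 : 2 ≤ #(meets (below P r)) := by
    by_contra hlt
    exact hnotS (exists_inter_eq_of_card_meets_le_one (by omega) (by omega))
  have hJ2 : 2 ≤ #(joins (below P r)) := by
    by_contra hlt
    exact hnotC (exists_union_eq_of_card_joins_le_one (by omega) (by omega))
  -- permuted enumerations of `below`
  have hall213 : ∀ b ∈ below P r, b = b₂ ∨ b = b₁ ∨ b = b₃ := fun b hb => by rcases hall b hb with h | h | h <;> simp [h]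
  have hall312 : ∀ b ∈ below P r, b = b₃ ∨ b = b₁ ∨ b = b₂ := fun b hb => by rcases hall b hb with h | h | h <;> simp [h]
  have J : ∀ {x y : Finset α}, x ∈ below P r → y ∈ below P r → x ≠ y → x ∪ y ∈ joins (below P r) :=
    fun hx hy hxy => mem_joins_iff.2 ⟨_, hx, _, hy, hxy, rfl⟩
  have L : ∀ {x y : Finset α}, x ∈ below P r → y ∈ below P r → x ≠ y → x ∩ y ∈ meets (below P r) :=
    fun hx hy hxy => mem_meets_iff.2 ⟨_, hx, _, hy, hxy, rfl⟩
  have noM : ∀ {x y z : Finset α}, x ∈ below P r → y ∈ below P r → z ∈ below P r → x ≠ y → x ≠ z → y ≠ z →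
      (∀ b ∈ below P r, b = x ∨ b = y ∨ b = z) → x ∪ y = x ∪ z → False := by
    intro x y z hx hy hz hxy hxz hyz hcov hW
    have := newMeets_nonempty_of_union_eq hanti ha hx hy hz hxy hxz hyz hcov hW
    rw [h0] at this; exact absurd this not_nonempty_empty
  by_cases hJle : #(joins (below P r)) ≤ 2
  · -- two of the three joins coincide: type (3,2), impossible with no new meet
    exfalso
    by_cases e1 : b₁ ∪ b₂ = b₁ ∪ b₃
    · exact noM hb₁ hb₂ hb₃ h12 h13 h23 hall e1
    by_cases e2 : b₁ ∪ b₂ = b₂ ∪ b₃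
    · exact noM hb₂ hb₁ hb₃ h12.symm h23 h13 hall213 (by rw [union_comm b₂ b₁]; exact e2)
    by_cases e3 : b₁ ∪ b₃ = b₂ ∪ b₃
    · exact noM hb₃ hb₁ hb₂ h13.symm h23.symm h12 hall312 (by rw [union_comm b₃ b₁, union_comm b₃ b₂]; exact e3)
    · have hsub : ({b₁ ∪ b₂, b₁ ∪ b₃, b₂ ∪ b₃} : Finset (Finset α)) ⊆ joins (below P r) := by
        intro W hW
        simp only [mem_insert, mem_singleton] at hW
        rcases hW with rfl | rfl | rfl
        · exact J hb₁ hb₂ h12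
        · exact J hb₁ hb₃ h13
        · exact J hb₂ hb₃ h23
      have hcard : #({b₁ ∪ b₂, b₁ ∪ b₃, b₂ ∪ b₃} : Finset (Finset α)) = 3 := by
        rw [card_insert_of_notMem, card_pair e3]
        simp only [mem_insert, mem_singleton, not_or]; exact ⟨e1, e2⟩
      have := card_le_card hsub
      omega
  · -- `#joins = 3`, so `#meets ≤ 2`: two meets coincide, and the third differs (no sunflower): type (2,3)
    have hLle : #(meets (below P r)) ≤ 2 := by omega
    have noS : ∀ {x y z : Finset α}, x ∈ below P r → y ∈ below P r → z ∈ below P r → x ≠ y → x ≠ z → y ≠ z →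
        (∀ b ∈ below P r, b = x ∨ b = y ∨ b = z) → x ∩ y = x ∩ z → x ∩ y ≠ y ∩ z := by
      intro x y z hx hy hz hxy hxz hyz hcov hM hM'
      apply hnotS
      refine ⟨x ∩ y, fun b hb b' hb' hbb' => ?_⟩
      rcases hcov b hb with rfl | rfl | rfl <;> rcases hcov b' hb' with rfl | rfl | rfl
      · exact absurd rfl hbb'
      · rfl
      · exact hM.symm
      · exact inter_comm _ _
      · exact absurd rfl hbb'
      · exact hM'.symm
      · rw [inter_comm]; exact hM.symm
      · rw [inter_comm]; exact hM'.symm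
      · exact absurd rfl hbb'
    by_cases e1 : b₁ ∩ b₂ = b₁ ∩ b₃
    · exact three_le_card_newJoins_of_inter_eq hanti hA2 hb₁ hb₂ hb₃ h12 h13 h23 hall e1
        (noS hb₁ hb₂ hb₃ h12 h13 h23 hall e1) h0
    by_cases e2 : b₁ ∩ b₂ = b₂ ∩ b₃
    · have e2' : b₂ ∩ b₁ = b₂ ∩ b₃ := by rw [inter_comm b₂ b₁]; exact e2
      exact three_le_card_newJoins_of_inter_eq hanti hA2 hb₂ hb₁ hb₃ h12.symm h23 h13 hall213 e2'
        (noS hb₂ hb₁ hb₃ h12.symm h23 h13 hall213 e2') h0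
    by_cases e3 : b₁ ∩ b₃ = b₂ ∩ b₃
    · have e3' : b₃ ∩ b₁ = b₃ ∩ b₂ := by rw [inter_comm b₃ b₁, inter_comm b₃ b₂]; exact e3
      exact three_le_card_newJoins_of_inter_eq hanti hA2 hb₃ hb₁ hb₂ h13.symm h23.symm h12 hall312 e3'
        (noS hb₃ hb₁ hb₂ h13.symm h23.symm h12 hall312 e3') h0
    · exfalso
      have hsub : ({b₁ ∩ b₂, b₁ ∩ b₃, b₂ ∩ b₃} : Finset (Finset α)) ⊆ meets (below P r) := by
        intro Z hZ
        simp only [mem_insert, mem_singleton] at hZ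
        rcases hZ with rfl | rfl | rfl
        · exact L hb₁ hb₂ h12
        · exact L hb₁ hb₃ h13
        · exact L hb₂ hb₃ h23
      have hcard : #({b₁ ∩ b₂, b₁ ∩ b₃, b₂ ∩ b₃} : Finset (Finset α)) = 3 := by
        rw [card_insert_of_notMem, card_pair e3]
        simp only [mem_insert, mem_singleton, not_or]; exact ⟨e1, e2⟩
      have := card_le_card hsub
      omega

end Summit.CriticalPhenomena.PercolationContinuityZ3.Theorems.SahiColouredDaykin
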